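import Literature.NumberTheory.EllipticCurves.PastenHeightBoundsClassicalInputProofs
import HarnessLib

/-!
# Pasten 2024, Thm 1.9: decomposition of the named fact — the Shimura-curve input
# `log δ_{1,N} < (1/24 + ε) φ(D) M log N + log ∏_{p∣D} v_p(Δ_E) + O(ω(D))` and Thm 1.9 from it

Topic `NumberTheory/EllipticCurves`. FACT DECOMPOSITION (librarian, 2026-08-16) of the capped named
fact `Literature.NumberTheory.EllipticCurves.ModularForms.pasten2024_height_lt`
(`PastenHeightBounds.lean`; H. Pasten, *Shimura curves and the abc conjecture*, J. Number Theory
254 (2024) 214–335 = arXiv:1705.09251, Thm 1.9 = Cor 7.8: `h(E) < (P/φ(P))(ε + 1/48) φ(N) log N`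
for `E/ℚ` semi-stable away from `S`, `N ≫_{ε,S} 1`).

The three proof files `PastenHeightBounds{,ShimuraApproach,ClassicalInput}Proofs.lean` (all
PROVED) carry Pasten's §7.3 deduction Cor 7.8 ⇐ Thm 7.7 ⇐ Thm 7.6 + Thm 7.2 ⇐ (EqHDeg) + Thm 6.1 +
Thm 7.2, and discharge the classical input (EqHDeg) `h(E) ≤ ½ log δ + O(1)` from modularity:
`pasten2024_height_lt_of_modularity_of_thm_6_1_of_thm_7_2` derives the fact from the named fact
`nonempty_modularParametrizationData` (the Modularity Theorem with an integral Manin constant —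
Wiles, Taylor–Wiles, BCDT; Edixhoven) and two inline hypotheses `h61`, `h72` — Pasten's **Thm 6.1**
(first display, the refined Ribet–Takahashi comparison `log δ_{1,N} ≤ log δ_{D,M} +
log ∏_{p∣D} v_p(Δ_E) + 5.1 ω(D)`) and **Thm 7.2** (asymptotic clause, `log δ_{D,M} < (1/24 + ε)
φ(D) M log N` for `N ≫_ε 1`) — stated over an ABSTRACT degree function `δ W D M` standing for the
Shimura-curve degree `δ_{D,M}(E)` (the tree has no Shimura curves `X₀^D(M)`, Jacobians `J₀^D(M)`,
optimal quotients `A_{D,M}`, so `δ_{D,M}` cannot be named). What those two hypotheses deliver to the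
deduction is exactly their composite along every admissible factorisation `N = DM`, which no longer
mentions `δ_{D,M}`; this file names that composite as ONE fact (`def … : Prop`, D-0014) and proves
the assembly:

* `PastenShimura2024_log_minModularDegree_lt` — **Thm 6.1 (first display) with Thm 7.2
  (asymptotic clause)** (the inequality chain of the proof of Thm 7.6/7.7, p. 27): for some
  absolute constants `B, B'` and every `ε > 0` there is `N₂` such that for every elliptic curve
  `E/ℚ` (globally minimal model `W`) of conductor `N ≥ N₂` and every admissible factorisation
  `N = DM` (§2.1, p. 12: "`D, M` coprime positive integers with `D` the product of an even number
  of distinct prime factors, possibly `D = 1`"),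
  `log δ_min(W) < (1/24 + ε) φ(D) M log N + log ∏_{p∣D} v_p(Δ_E) + B ω(D) + B'`,
  where `δ_min(W) = minModularDegree W N` is the least degree of a modular parametrisation datum
  `X₀(N) → W` of the globally minimal model (Frey's minimal degree, `ModularDegreeMinimal.lean`) —
  the rendering `δ_{1,N} ↦ minModularDegree W N_W` of the consumer `h61`; it is implied by the two
  printed displays because `δ_min(W) ≤ 163 · δ_{1,N}(E)` (every parametrisation of `W` factors
  through the optimal quotient `A_{1,N}` and a minimal isogeny `A_{1,N} → E` has degree `≤ 163`,
  Mazur 1978 / Kenku 1982, Pasten §3 p. 13 and proof of Lemma 6.8; in the tree the named fact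
  `PastenShimura2024_minimalDegree_le_163_mul`), so `B = 5.1`, `B' = log 163` are admissible. The
  restriction to globally minimal `W` is essential (the data of a non-minimal model rescale the
  period lattice, cf. the docstring of `PastenShimura2024_minimalDegree_le_163_mul`).
* `pasten2024_height_lt_holds_of : nonempty_modularParametrizationData →
  PastenShimura2024_log_minModularDegree_lt → pasten2024_height_lt` — the abstract degree function
  fed to the in-tree deduction is `δ W D M := exp(log δ_min(W) − log ∏ − B ω(D) − B')` on globally
  minimal models (so that `h61` holds with equality) and `1` elsewhere (so that `h72` holds as soon
  as `N ≥ 2`).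

Nothing is restated: the parent bounds the Faltings height, the child bounds a modular degree. What
the child needs beyond the tree: Shimura curves over `ℚ`, the Jacquet–Langlands transfer to
`𝕋_{D,M}`, Ribet–Takahashi's comparison of degrees (Thm 6.1, §6) and Pasten's spectral bound
(Thm 7.2 via Thm 5.5, Prop 5.4, Prop 7.1).

## References

* [PastenShimura2024] H. Pasten, *Shimura curves and the abc conjecture*, J. Number Theory 254
  (2024) 214–335 = arXiv:1705.09251: §2.1 (admissible factorisations, p. 12), §3 p. 13, Thm 6.1
  (p. 20), Lemma 6.8, Thm 7.2 (p. 26), Thm 7.6–7.7 and Cor 7.8 (p. 27), Thm 1.9 (p. 7). READ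
  (held text, pp. 12, 20, 26–27).
* [Mazur1978] B. Mazur, *Rational isogenies of prime degree*, Invent. Math. 44 (1978);
  [Kenku1982] M. A. Kenku, J. London Math. Soc. 26 (1982).
-/

noncomputable section

open scoped Classical

namespace Literature.NumberTheory.EllipticCurves.ModularForms

open WeierstrassCurve Finset

/-! ### The Shimura-curve input, with `δ_{D,M}` eliminated (named fact) -/

/-- **Pasten 2024, Thm 6.1 (first display) composed with Thm 7.2 (asymptotic clause): the bound on
the modular degree along admissible factorisations.** Printed: Thm 6.1 (p. 20), "Let `E` be an
elliptic curve over `ℚ` of conductor `N` and let `N = DM` be an admissible factorization. … In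
particular, we have `log δ_{1,N} ≤ log δ_{D,M} + log(∏_{p∣D} v_p(Δ_E)) + 5.1 · ω(D)`"; Thm 7.2
(p. 26), "given any `ε > 0`, for `N ≫_ε 1` with an effective implicit constant, we have
`log δ_{D,M} < (1/24 + ε) φ(D) M log N`". Rendering (module docstring): there are `B, B' ∈ ℝ` such
that for every `ε > 0` there is `N₂` with
`log (minModularDegree W N) < (1/24 + ε) · φ(D) · M · log N + log ∏_{p∣D} v_p(Δ_min(W)) + B · ω(D) + B'`
for every elliptic, GLOBALLY MINIMAL `W/ℚ` of conductor `N = W.conductorNorm ℤ ≥ N₂` and every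
admissible factorisation `N = D · M` (`D` squarefree with an even number of prime factors, coprime
to `M`); `minModularDegree W N` is Frey's minimal degree of a parametrisation datum of `W`
(`≤ 163 · δ_{1,N}` by Mazur–Kenku, whence `B = 5.1`, `B' = log 163` from print),
`v_p(Δ_min) = (W.minimalDiscriminantNorm ℤ).factorization p`, `ω(D) = #D.primeFactors`,
`φ = Nat.totient`. Effectivity of `N₂` is dropped. Named fact (D-0014), the composite of the
hypotheses `h61`, `h72` of `pasten2024_height_lt_of_modularity_of_thm_6_1_of_thm_7_2`.
[cite: PastenShimura2024, Thm 6.1 (first display, p. 20) and Thm 7.2 (asymptotic clause, p. 26), with §2.1 p. 12 (admissible) and §3 p. 13 (Mazur–Kenku)] -/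
def PastenShimura2024_log_minModularDegree_lt : Prop :=
  ∃ B B' : ℝ, ∀ ε : ℝ, 0 < ε → ∃ N₂ : ℕ,
    ∀ (W : WeierstrassCurve ℚ) [W.IsElliptic] [W.IsGloballyMinimal] [NeZero (W.conductorNorm ℤ)]
      (D M : ℕ), W.conductorNorm ℤ = D * M → Squarefree D → Even D.primeFactors.card → D.Coprime M →
      N₂ ≤ W.conductorNorm ℤ →
        Real.log (minModularDegree W (W.conductorNorm ℤ) : ℝ) <
          (1 / 24 + ε) * (Nat.totient D : ℝ) * (M : ℝ) * Real.log (W.conductorNorm ℤ) +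
            Real.log (∏ p ∈ D.primeFactors, ((W.minimalDiscriminantNorm ℤ).factorization p : ℝ)) +
            B * D.primeFactors.card + B'

/-! ### Assembly: Thm 1.9 from modularity and the Shimura-curve input -/

/-- **Pasten's Thm 1.9 (`pasten2024_height_lt`) from the Modularity Theorem and the Shimura-curve
input.** Given `nonempty_modularParametrizationData` (modularity with an integral Manin constant)
and `PastenShimura2024_log_minModularDegree_lt` (Thm 6.1 with Thm 7.2), the in-tree deduction
`pasten2024_height_lt_of_modularity_of_thm_6_1_of_thm_7_2` applies with the abstract Shimura degree
`δ W D M := exp(log δ_min(W) − log ∏_{p∣D} v_p(Δ) − B ω(D) − B')` on globally minimal models of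
non-zero conductor (then its `h61` is an equality) and `δ := 1` elsewhere (then its `h72` reads
`0 < (1/24 + ε) φ(D) M log N`, true for `N ≥ 2`). The discharge `pasten2024_height_lt_holds` is this
theorem applied to the two `_holds`. [cite: PastenShimura2024, Thm 1.9 via Thm 6.1, Thm 7.2, Thm 7.6, Thm 7.7, Cor 7.8 (pp. 20, 26–27)] -/
theorem pasten2024_height_lt_holds_of (hmod : nonempty_modularParametrizationData)
    (hδ : PastenShimura2024_log_minModularDegree_lt) : pasten2024_height_lt := by
  obtain ⟨B, B', hB⟩ := hδ
  -- the correction term of Thm 6.1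
  let R : WeierstrassCurve ℚ → ℕ → ℕ → ℝ := fun W D M =>
    Real.log (∏ p ∈ D.primeFactors, ((W.minimalDiscriminantNorm ℤ).factorization p : ℝ)) +
      B * D.primeFactors.card + B'
  -- the abstract Shimura degree
  let δ : WeierstrassCurve ℚ → ℕ → ℕ → ℝ := fun W D M =>
    if h : W.IsGloballyMinimal ∧ W.conductorNorm ℤ ≠ 0 then
      Real.exp (Real.log (@minModularDegree W (W.conductorNorm ℤ) ⟨h.2⟩ : ℝ) - R W D M)
    else 1
  refine pasten2024_height_lt_of_modularity_of_thm_6_1_of_thm_7_2 hmod δ B B' ?_ ?_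
  · -- `h61` with equality
    intro W _ hWm hN D M _ _ _ _
    have h : W.IsGloballyMinimal ∧ W.conductorNorm ℤ ≠ 0 := ⟨hWm, hN.out⟩
    have hδW : δ W D M =
        Real.exp (Real.log (minModularDegree W (W.conductorNorm ℤ) : ℝ) - R W D M) := by
      simp only [δ, dif_pos h]
    rw [hδW, Real.log_exp]
    simp only [R]
    linarith
  · -- `h72` from the child on globally minimal models, trivially elsewhere
    intro ε hε
    obtain ⟨N₂, hN₂⟩ := hB ε hε
    refine ⟨max N₂ 2, fun W _ D M hDM hD hDe hcop hN => ?_⟩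
    have hN2 : 2 ≤ W.conductorNorm ℤ := le_trans (le_max_right _ _) hN
    have hN₂' : N₂ ≤ W.conductorNorm ℤ := le_trans (le_max_left _ _) hN
    by_cases h : W.IsGloballyMinimal ∧ W.conductorNorm ℤ ≠ 0
    · haveI : W.IsGloballyMinimal := h.1
      haveI : NeZero (W.conductorNorm ℤ) := ⟨h.2⟩
      have hδW : δ W D M =
          Real.exp (Real.log (minModularDegree W (W.conductorNorm ℤ) : ℝ) - R W D M) := by
        simp only [δ, dif_pos h]
      rw [hδW, Real.log_exp]
      have hlt := hN₂ W D M hDM hD hDe hcop hN₂'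
      simp only [R]
      linarith
    · have hδW : δ W D M = 1 := by simp only [δ, dif_neg h]
      rw [hδW, Real.log_one]
      have hNpos : 0 < W.conductorNorm ℤ := by omega
      have hD0 : 0 < D := by
        rcases Nat.eq_zero_or_pos D with rfl | hD0
        · rw [zero_mul] at hDM; omega
        · exact hD0
      have hM0 : 0 < M := by
        rcases Nat.eq_zero_or_pos M with rfl | hM0
        · rw [mul_zero] at hDM; omega
        · exact hM0
      have hφ : (0 : ℝ) < (Nat.totient D : ℝ) := by exact_mod_cast Nat.totient_pos.mpr hD0
      have hM : (0 : ℝ) < (M : ℝ) := by exact_mod_cast hM0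
      have hlog : 0 < Real.log (W.conductorNorm ℤ) := Real.log_pos (by exact_mod_cast hN2)
      have hε' : (0 : ℝ) < 1 / 24 + ε := by positivity
      exact mul_pos (mul_pos (mul_pos hε' hφ) hM) hlog

end Literature.NumberTheory.EllipticCurves.ModularForms

end
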